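/-
Origin: expansion seat `planner-pub-hodgecm-pv02-g3-0`, handover #13 2026-08-18T06:26:50Z (`HOME/pub-hodgecm-pv02-g3/lean/Pv02g3/PerL34/GenericLine.lean`, md5 0896892c, 117 lines);
landed by the gen-7 packager in gate run 25 as `HodgeCM/PerL34/GenericLine.lean` (stripped 2 #print/#check/#eval lines).
-/
/-
Origin: planner-pub-hodgecm-pv02-g3-0 (unit pub-hodgecm-pv02-g3, DAG-NODE PROVER #02 gen 3), 2026-08-18.
Proposed tree path: `HodgeCM/PerL34/GenericLine.lean` (new, additive).  Imports LANDED `HodgeCM.PerL34.Ball` only.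
KERNEL: nothing cited, nothing asserted.
-/
import Summits.HodgeConjecture.HodgeCM.PerL34.Ball_2

/-!
# Complex lines through the origin of the ball (restriction step of `SplitHolForms.OrbitSpansDisjoint`)

* `linePt m t h : Ball` — the point `(t, m t)` for `‖t‖² (1 + ‖m‖²) < 1`;
* `lineParam_infinite m` — the admissible parameter set `{t | ‖t‖² (1 + ‖m‖²) < 1}` is infinite (it contains
  the reals `1/(n+2) / (1 + ‖m‖)`);
* `affine_eq_zero_of_two_lines` — an affine function `a x₀ + b x₁ + c` vanishing along the admissible parts of two
  distinct lines `x₁ = m x₀`, `x₁ = m' x₀` is zero.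
-/

noncomputable section

namespace HodgeCM
namespace PerL34
namespace GenericLine

open HodgeCM.PerL34.BallModel

/-- The admissible parameters of the line of slope `m`. -/
def lineParam (m : ℂ) : Set ℂ := {t | ‖t‖ ^ 2 * (1 + ‖m‖ ^ 2) < 1}

/-- (Ported verbatim from the HodgeCMPerL package; no docstring in the source.) -/
theorem mem_lineParam {m t : ℂ} : t ∈ lineParam m ↔ ‖t‖ ^ 2 * (1 + ‖m‖ ^ 2) < 1 := Iff.rfl

/-- (Ported verbatim from the HodgeCMPerL package; no docstring in the source.) -/
theorem nsq_line (m t : ℂ) : nsq ![t, m * t] = ‖t‖ ^ 2 * (1 + ‖m‖ ^ 2) := by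
  simp [nsq]
  ring

/-- The point `(t, m t)` of the ball. -/
def linePt (m t : ℂ) (h : t ∈ lineParam m) : Ball := ⟨![t, m * t], by rw [nsq_line]; exact h⟩

/-- (Ported verbatim from the HodgeCMPerL package; no docstring in the source.) -/
@[simp] theorem linePt_val_zero (m t : ℂ) (h : t ∈ lineParam m) : (linePt m t h).1 0 = t := rfl
/-- (Ported verbatim from the HodgeCMPerL package; no docstring in the source.) -/
@[simp] theorem linePt_val_one (m t : ℂ) (h : t ∈ lineParam m) : (linePt m t h).1 1 = m * t := rfl

/-- (Ported verbatim from the HodgeCMPerL package; no docstring in the source.) -/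
theorem zero_mem_lineParam (m : ℂ) : (0 : ℂ) ∈ lineParam m := by
  simp [mem_lineParam]

/-- The real points `1 / ((n + 2) (1 + ‖m‖))` are admissible. -/
theorem seq_mem_lineParam (m : ℂ) (n : ℕ) : ((1 : ℂ) / ((n + 2) * (1 + ‖m‖))) ∈ lineParam m := by
  rw [mem_lineParam]
  have hm : (0 : ℝ) ≤ ‖m‖ := norm_nonneg m
  have hn : (2 : ℝ) ≤ (n : ℝ) + 2 := by
    have : (0 : ℝ) ≤ n := Nat.cast_nonneg n
    linarith
  have hpos : (0 : ℝ) < ((n : ℝ) + 2) * (1 + ‖m‖) := by positivity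
  have hnorm : ‖((1 : ℂ) / ((n + 2) * (1 + ‖m‖)))‖ = 1 / (((n : ℝ) + 2) * (1 + ‖m‖)) := by
    rw [norm_div, norm_one, norm_mul]
    congr 1
    rw [show ((n : ℂ) + 2) = ((n + 2 : ℝ) : ℂ) by push_cast; ring, Complex.norm_real,
      show ((1 : ℂ) + ‖m‖) = ((1 + ‖m‖ : ℝ) : ℂ) by push_cast; ring, Complex.norm_real,
      Real.norm_of_nonneg (by linarith), Real.norm_of_nonneg (by linarith)]
  rw [hnorm]
  -- `(1/(N(1+‖m‖)))² (1+‖m‖²) ≤ (1/N²) · ((1+‖m‖²)/(1+‖m‖)²) ≤ 1/4 < 1`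
  have h1 : 1 + ‖m‖ ^ 2 ≤ (1 + ‖m‖) ^ 2 := by nlinarith
  have hN : ((1 : ℝ) / (((n : ℝ) + 2) * (1 + ‖m‖))) ^ 2 * (1 + ‖m‖) ^ 2 = 1 / ((n : ℝ) + 2) ^ 2 := by
    field_simp
  calc ((1 : ℝ) / (((n : ℝ) + 2) * (1 + ‖m‖))) ^ 2 * (1 + ‖m‖ ^ 2)
      ≤ ((1 : ℝ) / (((n : ℝ) + 2) * (1 + ‖m‖))) ^ 2 * (1 + ‖m‖) ^ 2 := by
        apply mul_le_mul_of_nonneg_left h1; positivity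
    _ = 1 / ((n : ℝ) + 2) ^ 2 := hN
    _ ≤ 1 / 4 := by
        apply div_le_div_of_nonneg_left (by norm_num) (by norm_num)
        nlinarith
    _ < 1 := by norm_num

/-- The admissible parameter set is infinite. -/
theorem lineParam_infinite (m : ℂ) : (lineParam m).Infinite := by
  have hinj : Function.Injective fun n : ℕ => ((1 : ℂ) / ((n + 2) * (1 + ‖m‖))) := by
    intro n n' h
    have hm : ((1 : ℂ) + ‖m‖) ≠ 0 := by
      rw [show ((1 : ℂ) + ‖m‖) = ((1 + ‖m‖ : ℝ) : ℂ) by push_cast; ring, Complex.ofReal_ne_zero]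
      have := norm_nonneg m; linarith
    have h2 : ∀ k : ℕ, ((k : ℂ) + 2) ≠ 0 := fun k => by
      rw [show ((k : ℂ) + 2) = ((k + 2 : ℕ) : ℂ) by push_cast; ring]; exact Nat.cast_ne_zero.mpr (by omega)
    simp only [one_div, mul_inv_rev, mul_eq_mul_left_iff, inv_eq_zero, hm, or_false, inv_inj] at h
    exact_mod_cast (add_left_inj (2 : ℂ)).mp h
  exact Set.infinite_of_injective_forall_mem hinj (seq_mem_lineParam m)

/-- An affine function vanishing along the admissible parts of two distinct lines through `0` vanishes. -/
theorem affine_eq_zero_of_two_lines (a b c m m' : ℂ) (hmm : m ≠ m')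
    (h : ∀ t ∈ lineParam m, a * t + b * (m * t) + c = 0)
    (h' : ∀ t ∈ lineParam m', a * t + b * (m' * t) + c = 0) : a = 0 ∧ b = 0 ∧ c = 0 := by
  have hc : c = 0 := by simpa using h 0 (zero_mem_lineParam m)
  subst hc
  -- a non-zero admissible parameter on each line
  obtain ⟨t, ht, ht0⟩ : ∃ t ∈ lineParam m, t ≠ 0 :=
    ((lineParam_infinite m).sdiff (Set.finite_singleton 0)).nonempty.imp fun t ht => ⟨ht.1, ht.2⟩
  obtain ⟨t', ht', ht0'⟩ : ∃ t ∈ lineParam m', t ≠ 0 :=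
    ((lineParam_infinite m').sdiff (Set.finite_singleton 0)).nonempty.imp fun t ht => ⟨ht.1, ht.2⟩
  have e1 : a + b * m = 0 := by
    have := h t ht
    rw [add_zero, show a * t + b * (m * t) = (a + b * m) * t by ring] at this
    exact (mul_eq_zero.mp this).resolve_right ht0
  have e2 : a + b * m' = 0 := by
    have := h' t' ht'
    rw [add_zero, show a * t' + b * (m' * t') = (a + b * m') * t' by ring] at this
    exact (mul_eq_zero.mp this).resolve_right ht0'
  have hb : b = 0 := by
    have : b * (m - m') = 0 := by linear_combination e1 - e2
    exact (mul_eq_zero.mp this).resolve_right (sub_ne_zero.mpr hmm)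
  subst hb
  refine ⟨by simpa using e1, rfl, rfl⟩

end GenericLine
end PerL34
end HodgeCM

end

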